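import Summits.BirchSwinnertonDyer.BirchSwinnertonDyer.Theorems.ManinLocalTwoThreeBoundaryHeckeOperators
import HarnessLib

/-!
# Shift operators `ρ_r`, `ρ_r⁻¹` and the transposed Hecke operator `T♯_r = r ρ_r + ρ_r⁻¹` on invariant cusp functions

Summit `BirchSwinnertonDyer`, route `ManinLocalTwoThree` (cell bsd-f2-manin), cruxes C2 `ManinOddAtFour`
(stmt-BirchSwinnertonDyer-22967) / C3 `ManinPrimeToThreeAtNine` (stmt-BirchSwinnertonDyer-22968).  Toward N4 PARABOLICITY
(MEMO-es §22.2 (0); cell REF1 §R43 N4; p3 2026-08-28T03:17:26Z (C)): «a generalised `λ`-eigen `u ∈ Hom(Γ₀(L), K̄)` with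
`λ` non-Eisenstein kills every cusp-fixing element» — the `H¹`-side twin of E-es-30, where the Hecke operators act on the
cusp data `x ↦ u(g_x T^w g_x⁻¹)` through the TRANSPOSED weights `T♯_r = r ρ_r + ρ_r⁻¹` (one fixed point of weight `r`,
one `r`-cycle of weight `1`).  This file sets up the operators on `cuspInvariants M K` (functions, not symbols):
`A_r = LinearMap.funLeft K K (heckeNbrInfty hr)` (`(A_r w)(x) = w(ρ_r x)`), `B_r = LinearMap.funLeft K K (heckeNbrZero hr)`,
`T♯_r = r • A_r + B_r`; on `cuspInvariants M K` (primes `q, r ∤ M`): stability, `A_rB_r = B_rA_r = 1`, `A_qA_r = A_rA_q`,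
`A_qB_r = B_rA_q`, `A_qT♯_r = T♯_rA_q`, `A_q` preserves `cuspInvariants ∩` (generalised `μ`-eigenspace of `T♯_r`),
`A_{r₂}A_{r₁} = A_u` (`r₁r₂ ≡ u`), `A_u = 1` (`u ≡ 1`), `A_r = A_{r'}` (`r ≡ r'`) — verbatim the symbol-side list of
`Theorems/ManinLocalTwoThreeBoundaryHeckeOperators.lean`, from the orbit relations of
`Theorems/ManinLocalTwoThreeCuspHeckeShiftRelations.lean`.  No new definitions; nothing about BSD or Manin's conjecture is
proved here.

References: G. Shimura (1971) §8.3; F. Diamond, J. Shurman, GTM 228, Prop. 3.8.3, §5.2; cell memo HOME/MEMO-es.md §22.2–22.3.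
-/

set_option autoImplicit false
set_option linter.dupNamespace false

open scoped MatrixGroups

open CongruenceSubgroup Matrix.SpecialLinearGroup Literature.NumberTheory.EllipticCurves.ModularForms

namespace Summit.BirchSwinnertonDyer.BirchSwinnertonDyer.Theorems.ManinLocalTwoThree

section FunOperators

variable (M : ℕ) {K : Type*} [CommRing K] {r q : ℕ} [NeZero r] [NeZero q] (hr : r.Prime) (hq : q.Prime)

/-- Unfolding membership in `cuspInvariants` as a pointwise identity (plumbing). [folklore] -/
theorem cuspInvariants_apply {w : OnePoint ℚ → K} (hw : w ∈ cuspInvariants M K) (γ : Gamma0 M) (x : OnePoint ℚ) :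
    w ((mapGL ℚ (γ : SL(2, ℤ)) : GL (Fin 2) ℚ) • x) = w x :=
  (mem_cuspInvariants M K w).mp hw γ x

/-- `A_q` preserves `cuspInvariants M K` (`q ∤ M`). [cite: DiamondShurman2005, Prop. 3.8.3] -/
theorem funLeft_heckeNbrInfty_mem (hMq : ¬ q ∣ M) {w : OnePoint ℚ → K} (hw : w ∈ cuspInvariants M K) :
    LinearMap.funLeft K K (heckeNbrInfty hq) w ∈ cuspInvariants M K := by
  rw [mem_cuspInvariants]
  intro γ x
  rw [LinearMap.funLeft_apply, LinearMap.funLeft_apply]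
  obtain ⟨γ', h⟩ := sameOrbit_heckeNbrInfty hq M hMq (x := x) ⟨γ, rfl⟩
  rw [← h, cuspInvariants_apply M hw]

/-- `B_q` preserves `cuspInvariants M K` (`q ∤ M`). [cite: DiamondShurman2005, Prop. 3.8.3] -/
theorem funLeft_heckeNbrZero_mem (hMq : ¬ q ∣ M) {w : OnePoint ℚ → K} (hw : w ∈ cuspInvariants M K) :
    LinearMap.funLeft K K (heckeNbrZero hq) w ∈ cuspInvariants M K := by
  rw [mem_cuspInvariants]
  intro γ x
  rw [LinearMap.funLeft_apply, LinearMap.funLeft_apply]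
  obtain ⟨γ', h⟩ := sameOrbit_heckeNbrZero hq M hMq (x := x) ⟨γ, rfl⟩
  rw [← h, cuspInvariants_apply M hw]

/-- **`B_r A_r = 1`** on `cuspInvariants` (as `funLeft`: `w(ρ_r(ρ_r⁻¹ x)) = w(x)`) (`r ∤ M`). [cite: DiamondShurman2005, Prop. 3.8.3] -/
theorem funLeft_zero_infty (hM : ¬ r ∣ M) {w : OnePoint ℚ → K} (hw : w ∈ cuspInvariants M K) :
    LinearMap.funLeft K K (heckeNbrZero hr) (LinearMap.funLeft K K (heckeNbrInfty hr) w) = w := by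
  funext x
  rw [LinearMap.funLeft_apply, LinearMap.funLeft_apply]
  obtain ⟨γ, h⟩ := sameOrbit_heckeNbrInfty_heckeNbrZero hr M hM x
  conv_rhs => rw [← h, cuspInvariants_apply M hw]

/-- **`A_r B_r = 1`** on `cuspInvariants` (`r ∤ M`). [cite: DiamondShurman2005, Prop. 3.8.3] -/
theorem funLeft_infty_zero (hM : ¬ r ∣ M) {w : OnePoint ℚ → K} (hw : w ∈ cuspInvariants M K) :
    LinearMap.funLeft K K (heckeNbrInfty hr) (LinearMap.funLeft K K (heckeNbrZero hr) w) = w := by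
  funext x
  rw [LinearMap.funLeft_apply, LinearMap.funLeft_apply]
  obtain ⟨γ, h⟩ := sameOrbit_heckeNbrZero_heckeNbrInfty hr M hM x
  conv_rhs => rw [← h, cuspInvariants_apply M hw]

/-- **`A_q A_r = A_r A_q`** on `cuspInvariants` (`q, r ∤ M`). [cite: DiamondShurman2005, Prop. 3.8.3] -/
theorem funLeft_infty_comm (hM : ¬ r ∣ M) (hMq : ¬ q ∣ M) {w : OnePoint ℚ → K} (hw : w ∈ cuspInvariants M K) :
    LinearMap.funLeft K K (heckeNbrInfty hq) (LinearMap.funLeft K K (heckeNbrInfty hr) w) =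
      LinearMap.funLeft K K (heckeNbrInfty hr) (LinearMap.funLeft K K (heckeNbrInfty hq) w) := by
  funext x
  simp only [LinearMap.funLeft_apply]
  obtain ⟨γ, h⟩ := sameOrbit_heckeNbrInfty_comm M hr hq hM hMq x
  rw [← h, cuspInvariants_apply M hw]

/-- **`A_q B_r = B_r A_q`** on `cuspInvariants` (`q, r ∤ M`). [cite: DiamondShurman2005, Prop. 3.8.3] -/
theorem funLeft_infty_zero_comm (hM : ¬ r ∣ M) (hMq : ¬ q ∣ M) {w : OnePoint ℚ → K} (hw : w ∈ cuspInvariants M K) :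
    LinearMap.funLeft K K (heckeNbrInfty hq) (LinearMap.funLeft K K (heckeNbrZero hr) w) =
      LinearMap.funLeft K K (heckeNbrZero hr) (LinearMap.funLeft K K (heckeNbrInfty hq) w) := by
  have h1 := funLeft_heckeNbrZero_mem M hr hM hw
  have h2 := funLeft_heckeNbrInfty_mem M hq hMq h1
  calc LinearMap.funLeft K K (heckeNbrInfty hq) (LinearMap.funLeft K K (heckeNbrZero hr) w)
      = LinearMap.funLeft K K (heckeNbrZero hr) (LinearMap.funLeft K K (heckeNbrInfty hr)
          (LinearMap.funLeft K K (heckeNbrInfty hq) (LinearMap.funLeft K K (heckeNbrZero hr) w))) :=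
        (funLeft_zero_infty M hr hM h2).symm
    _ = LinearMap.funLeft K K (heckeNbrZero hr) (LinearMap.funLeft K K (heckeNbrInfty hq)
          (LinearMap.funLeft K K (heckeNbrInfty hr) (LinearMap.funLeft K K (heckeNbrZero hr) w))) := by
        rw [funLeft_infty_comm M hq hr hMq hM h1]
    _ = LinearMap.funLeft K K (heckeNbrZero hr) (LinearMap.funLeft K K (heckeNbrInfty hq) w) := by
        rw [funLeft_infty_zero M hr hM hw]

/-- `T♯_r = r A_r + B_r` preserves `cuspInvariants` (`r` prime `∤ M`). [cite: Shimura1971, §8.3 (8.3.2)] -/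
theorem sharp_mem (hM : ¬ r ∣ M) {w : OnePoint ℚ → K} (hw : w ∈ cuspInvariants M K) :
    ((r : K) • LinearMap.funLeft K K (heckeNbrInfty hr) + LinearMap.funLeft K K (heckeNbrZero hr)) w ∈
      cuspInvariants M K := by
  rw [LinearMap.add_apply, LinearMap.smul_apply]
  exact Submodule.add_mem _ (Submodule.smul_mem _ _ (funLeft_heckeNbrInfty_mem M hr hM hw))
    (funLeft_heckeNbrZero_mem M hr hM hw)

/-- **`A_q T♯_r = T♯_r A_q`** on `cuspInvariants` (`q, r` primes `∤ M`). [cite: Shimura1971, §8.3 (8.3.2)] -/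
theorem sharp_funLeft_comm (hM : ¬ r ∣ M) (hMq : ¬ q ∣ M) {w : OnePoint ℚ → K} (hw : w ∈ cuspInvariants M K) :
    ((r : K) • LinearMap.funLeft K K (heckeNbrInfty hr) + LinearMap.funLeft K K (heckeNbrZero hr))
        (LinearMap.funLeft K K (heckeNbrInfty hq) w) =
      LinearMap.funLeft K K (heckeNbrInfty hq)
        (((r : K) • LinearMap.funLeft K K (heckeNbrInfty hr) + LinearMap.funLeft K K (heckeNbrZero hr)) w) := by
  rw [LinearMap.add_apply, LinearMap.smul_apply, LinearMap.add_apply, LinearMap.smul_apply, map_add, map_smul,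
    funLeft_infty_comm M hq hr hMq hM hw, funLeft_infty_zero_comm M hr hq hM hMq hw]

/-- **`A_q` preserves `cuspInvariants ∩` (generalised `μ`-eigenspace of `T♯_r`)** (`q, r` primes `∤ M`).
[cite: Shimura1971, §8.3 (8.3.2)] -/
theorem funLeft_mem_maxGenEigenspace_sharp (hM : ¬ r ∣ M) (hMq : ¬ q ∣ M) {w : OnePoint ℚ → K}
    (hw : w ∈ cuspInvariants M K) {μ : K}
    (hgen : w ∈ Module.End.maxGenEigenspace
      ((r : K) • LinearMap.funLeft K K (heckeNbrInfty hr) + LinearMap.funLeft K K (heckeNbrZero hr)) μ) :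
    LinearMap.funLeft K K (heckeNbrInfty hq) w ∈ Module.End.maxGenEigenspace
      ((r : K) • LinearMap.funLeft K K (heckeNbrInfty hr) + LinearMap.funLeft K K (heckeNbrZero hr)) μ := by
  set T : Module.End K (OnePoint ℚ → K) :=
    (r : K) • LinearMap.funLeft K K (heckeNbrInfty hr) + LinearMap.funLeft K K (heckeNbrZero hr) with hT
  rw [Module.End.mem_maxGenEigenspace] at hgen ⊢
  obtain ⟨k, hk⟩ := hgen
  refine ⟨k, ?_⟩
  have key : ∀ n : ℕ, ∀ v ∈ cuspInvariants M K, ((T - μ • 1) ^ n) v ∈ cuspInvariants M K ∧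
      ((T - μ • 1) ^ n) (LinearMap.funLeft K K (heckeNbrInfty hq) v) =
        LinearMap.funLeft K K (heckeNbrInfty hq) (((T - μ • 1) ^ n) v) := by
    intro n
    induction n with
    | zero =>
      intro v hv
      refine ⟨?_, ?_⟩
      · simpa only [pow_zero, Module.End.one_apply] using hv
      · simp only [pow_zero, Module.End.one_apply]
    | succ n ih =>
      intro v hv
      have hv1 : (T - μ • 1) v ∈ cuspInvariants M K := by
        rw [LinearMap.sub_apply, LinearMap.smul_apply, Module.End.one_apply]
        exact Submodule.sub_mem _ (sharp_mem M hr hM hv) (Submodule.smul_mem _ _ hv)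
      obtain ⟨ihmem, iheq⟩ := ih _ hv1
      refine ⟨?_, ?_⟩
      · rw [pow_succ, Module.End.mul_apply]
        exact ihmem
      · rw [pow_succ, Module.End.mul_apply, Module.End.mul_apply, ← iheq]
        congr 1
        rw [LinearMap.sub_apply, LinearMap.sub_apply, LinearMap.smul_apply, LinearMap.smul_apply,
          Module.End.one_apply, Module.End.one_apply, map_sub, map_smul, hT, sharp_funLeft_comm M hr hq hM hMq hv]
  rw [(key k w hw).2, hk, map_zero]

/-- **`A_{r₂} A_{r₁} = A_u` on `cuspInvariants` when `r₁ r₂ ≡ u (mod M)`** (primes `∤ M`). [cite: DiamondShurman2005, Prop. 3.8.3] -/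
theorem funLeft_infty_mul_of_dvd {r₁ r₂ u : ℕ} [NeZero r₁] [NeZero r₂] [NeZero u]
    (h₁ : r₁.Prime) (h₂ : r₂.Prime) (hu : u.Prime) (hM₁ : ¬ r₁ ∣ M) (hM₂ : ¬ r₂ ∣ M) (hMu : ¬ u ∣ M)
    (hcong : (M : ℤ) ∣ (r₁ : ℤ) * r₂ - u) {w : OnePoint ℚ → K} (hw : w ∈ cuspInvariants M K) :
    LinearMap.funLeft K K (heckeNbrInfty h₂) (LinearMap.funLeft K K (heckeNbrInfty h₁) w) =
      LinearMap.funLeft K K (heckeNbrInfty hu) w := by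
  funext x
  simp only [LinearMap.funLeft_apply]
  obtain ⟨γ, h⟩ := sameOrbit_heckeNbrInfty_heckeNbrInfty_of_dvd M h₁ h₂ hu hM₁ hM₂ hMu hcong x
  rw [← h, cuspInvariants_apply M hw]

/-- **`A_u = 1` on `cuspInvariants` when `u ≡ 1 (mod M)`**. [cite: DiamondShurman2005, Prop. 3.8.3] -/
theorem funLeft_infty_of_dvd_sub_one {u : ℕ} [NeZero u] (hu : u.Prime) (hMu : ¬ u ∣ M)
    (hcong : (M : ℤ) ∣ (u : ℤ) - 1) {w : OnePoint ℚ → K} (hw : w ∈ cuspInvariants M K) :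
    LinearMap.funLeft K K (heckeNbrInfty hu) w = w := by
  funext x
  rw [LinearMap.funLeft_apply]
  obtain ⟨γ, h⟩ := sameOrbit_heckeNbrInfty_self_of_dvd M hu hMu hcong x
  conv_rhs => rw [← h, cuspInvariants_apply M hw]

/-- **`A_r = A_{r'}` on `cuspInvariants` when `r ≡ r' (mod M)`**. [cite: DiamondShurman2005, Prop. 3.8.3] -/
theorem funLeft_infty_congr {r' : ℕ} [NeZero r'] (hr' : r'.Prime) (hM : ¬ r ∣ M) (hM' : ¬ r' ∣ M)
    (hcong : (M : ℤ) ∣ (r : ℤ) - r') {w : OnePoint ℚ → K} (hw : w ∈ cuspInvariants M K) :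
    LinearMap.funLeft K K (heckeNbrInfty hr) w = LinearMap.funLeft K K (heckeNbrInfty hr') w := by
  funext x
  simp only [LinearMap.funLeft_apply]
  obtain ⟨γ, h⟩ := sameOrbit_heckeNbrInfty_of_dvd M hr hr' hM hM' hcong x
  rw [← h, cuspInvariants_apply M hw]

end FunOperators

end Summit.BirchSwinnertonDyer.BirchSwinnertonDyer.Theorems.ManinLocalTwoThree
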